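import Mathlib
import Literature.NumberTheory.LFunctions.Zhang2022.Section14Summability
import HarnessLib

/-!
# Zhang (2022) §14, towards (14.6): the character expansion of `𝒮(D₁,D₂;p)` for a general
# factorisation `D = D₁D₂` — the (14.7)-identity at the modulus `D₂k`, kernel-checked

Topic `Literature/NumberTheory/LFunctions/Zhang2022` (Landau–Siegel audit tree; verdict-neutral).
Y. Zhang, *Discrete mean estimates and the Landau–Siegel zero*, arXiv:2211.02515v1 (2022)
[Zhang2022LandauSiegel] — **an unrefereed manuscript under adjudication**; nothing here asserts or
denies its Theorems 1–2 or Proposition 14.1. ZHANG-L discharge lane (helper under the leaf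
`Skeleton.Prop141`, node `Z22:(14.6)` = `Typed.Sec14.Eq146`, GAP row G-adj2-4 "the (14.6) analogue").

The manuscript proves (14.5) (the case `(D₁,D₂) = (1,D)` of `𝒮(D₁,D₂;p)`, `Typed.Sec14.calS`) via the
character expansion (14.7) and says of (14.6) only "The proof of (14.6) is similar … the constraint
`(k,D₁) = 1` implies `D ∤ D₂k` … the main terms … do not appear" (p. 79, tex L3966–L3969). This file
supplies the FIRST STEP of that unprinted argument, the twin of (14.7) (`eq147_holds`, which is typed for
`(1,D)` only) at the modulus `D₂k`:

* `tsum_coprime_twist_eq_sum_characters` — for one `k`: `Σ_{(l,Mk)=1} κ(l)Δ_l e(−lp̄/(Mk)) =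
  φ(Mk)⁻¹ Σ_{θ (mod Mk)} τ(θ̄)θ̄(p) Σ_l κ(l)θ(−l)Δ_l` for `(p,Mk) = 1`, termwise by u012
  (`step14u012_holds`), the interchange of `Σ_l` and `Σ_θ` being justified when the series converge
  absolutely and trivial otherwise (`|θ(−l)| = 𝟙_{(l,Mk)=1}`, so either all series converge absolutely
  or all are `0` in Mathlib's `tsum` convention). This is the (file-private) lemma behind `eq147_holds`
  of `TypedSection14Proofs`, re-proved here as a public theorem so that both moduli `Dk` and `D₂k` can use it.
* `calS_charExpansion` — **(14.7)′**: for all large `D`, every `p ∼ P`, every factorisation `D = D₁D₂`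
  and all sequences,
  `𝒮(D₁,D₂;p) = Σ_d d⁻¹ Σ_{(k,D₁)=1} a*(dk)/(kφ(D₂k)) Σ_{θ (mod D₂k)} τ(θ̄)θ̄(p) Σ_l κ*(D₁dl)θ(−l)Δ(l/(D₂pk))`
  (`(p, D₂k) = 1` because `k ≤ 2P₄ ≤ P < p` and `D < P < p`, `Section14GaussSums`).
* `sum_window_tsum_exchange₂`, `norm_sum_window_nonprincipal_le₂` — exchanging `Σ_{p∼P}` with the
  `l`-series (absolutely convergent under (14.1), `summable_kappa_mul_DeltaW`) and the resulting
  majorant of the non-principal characters' contribution by the (14.8)-shaped quantity at modulus `D₂k`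
  (all `θ ≠ ψ⁰_{D₂k}`; no `θ_k¹`-term is split off — for `D₁ > 1` none is induced by `χ`).
* `sum_characters_split_one`, `calS_split₂` — `Σ_{θ (mod N)} = [θ = ψ⁰] + Σ_{θ ≠ ψ⁰}` and the
  resulting per-`p` decomposition `𝒮(D₁,D₂;p) = principal + rest`.

Deliberately NOT here: the bound for the principal-character term (the u013 twin) and the two
(14.8)-type estimates at modulus `D₂k` (Mellin + Lemma 5.4 (i) + Lemma 5.6 / large sieve) — the
analytic legs of (14.6).

## References

* Y. Zhang, arXiv:2211.02515v1 (2022), §14 pp. 77–79: u011 (`𝒮(D₁,D₂;p)`), u012, (14.6), (14.7),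
  (14.8), tex L3901–L3969. [cite: Zhang2022LandauSiegel, §14 (14.6)–(14.8) pp.78–79]
* H. L. Montgomery, R. C. Vaughan, *Multiplicative Number Theory I*, CUP 2007, §9.2 (9.6)
  (`χ(n)τ(χ̄) = Σ_a χ̄(a)e(an/q)`). [cite: MontgomeryVaughan2007, §9.2]
-/

noncomputable section

open Complex Real ComplexConjugate

namespace Literature.NumberTheory.LFunctions.Zhang2022.Typed.Sec14

open Skeleton

/-! ## Helpers -/

/-- `‖e(y)‖ = 1`. [folklore] -/
private theorem norm_eAdd_eq_one' (y : ℝ) : ‖eAdd y‖ = 1 := by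
  rw [eAdd, show (2 * π * I * (y : ℂ)) = ((2 * π * y : ℝ) : ℂ) * I by push_cast; ring]
  exact Complex.norm_exp_ofReal_mul_I _

/-- `‖θ(−l)‖ = 1` if `(l,N) = 1` and `θ(−l) = 0` otherwise, for a character `θ (mod N)`. [folklore] -/
private theorem norm_char_neg_natCast' {N : ℕ} (θ : DirichletCharacter ℂ N) (l : ℕ) :
    ‖θ (-(l : ZMod N))‖ = if Nat.Coprime l N then 1 else 0 := by
  by_cases h : Nat.Coprime l N
  · rw [if_pos h]
    obtain ⟨u, hu⟩ := ((ZMod.isUnit_iff_coprime l N).mpr h).neg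
    rw [← hu]
    exact θ.unit_norm_eq_one u
  · rw [if_neg h]
    have hu : ¬ IsUnit (-(l : ZMod N)) := fun h' =>
      h ((ZMod.isUnit_iff_coprime l N).mp ((IsUnit.neg_iff _).mp h'))
    rw [MulChar.map_nonunit θ hu, norm_zero]

/-- Membership in `finsetOf S` for a finite set `S`. [folklore] -/
private theorem mem_finsetOf_iff' {α : Type*} {S : Set α} (hS : S.Finite) (x : α) :
    x ∈ finsetOf S ↔ x ∈ S := by
  rw [finsetOf, dif_pos hS, Set.Finite.mem_toFinset]

/-! ## The twisted `l`-series for one `k`: u012 summed against a series -/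

/-- **The `l`-series of (14.4)/(14.7) for one modulus `Mk`**: for `(p, Mk) = 1`,
`Σ_{(l,Mk)=1} κ(l)Δ_l e(−lp̄/(Mk)) = φ(Mk)⁻¹ Σ_{θ (mod Mk)} τ(θ̄)θ̄(p) Σ_l κ(l)θ(−l)Δ_l` — termwise the
orthogonality identity u012 (`step14u012_holds`), the interchange of `Σ_l` and the finite `Σ_θ` being
justified when the series converge absolutely and trivial (both sides `0`) otherwise, since
`|θ(−l)| = 𝟙_{(l,Mk)=1}`. (The same statement is the file-private `twisted_series_eq` of
`TypedSection14Proofs`; re-proved verbatim so that the modulus `D₂k` of (14.6) can use it.)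
[cite: Zhang2022LandauSiegel, §14 (14.7) p.78, tex L3924] -/
theorem tsum_coprime_twist_eq_sum_characters {M k p : ℕ} (hM : 0 < M) (hk : 0 < k)
    (hp : Nat.Coprime p (M * k)) (κ : ℕ → ℂ) (Δ : ℕ → ℂ) :
    (∑' l : ℕ, if Nat.Coprime l (M * k) then
        κ l * Δ l * eAdd (-((l : ℝ) * nInv (M * k) p / (M * k))) else 0) =
      (Nat.totient (M * k) : ℂ)⁻¹ *
        ∑ θ ∈ finsetOf (Set.univ : Set (DirichletCharacter ℂ (M * k))),
          tauSum (M * k) θ⁻¹ * θ⁻¹ (p : ZMod (M * k)) *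
            ∑' l : ℕ, κ l * θ (-(l : ZMod (M * k))) * Δ l := by
  set N := M * k with hN
  set S := finsetOf (Set.univ : Set (DirichletCharacter ℂ N)) with hS
  set c : DirichletCharacter ℂ N → ℂ := fun θ => tauSum N θ⁻¹ * θ⁻¹ (p : ZMod N) with hc
  -- termwise identity (u012)
  have hterm : ∀ l : ℕ,
      (if Nat.Coprime l N then κ l * Δ l * eAdd (-((l : ℝ) * nInv N p / (M * k))) else 0) =
        (Nat.totient N : ℂ)⁻¹ * ∑ θ ∈ S, c θ * (κ l * θ (-(l : ZMod N)) * Δ l) := by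
    intro l
    by_cases hl : Nat.Coprime l N
    · rw [if_pos hl, step14u012_holds M k p l hM hk hl hp, ← hN, Finset.mul_sum, Finset.mul_sum,
        Finset.mul_sum]
      refine Finset.sum_congr rfl fun θ _ => ?_
      simp only [hc]
      ring
    · rw [if_neg hl]
      have h0 : ∀ θ ∈ S, c θ * (κ l * θ (-(l : ZMod N)) * Δ l) = 0 := by
        intro θ _
        have : θ (-(l : ZMod N)) = 0 := by
          have hn := norm_char_neg_natCast' θ l
          rw [if_neg hl] at hn
          exact norm_eq_zero.mp hn
        rw [this]; ring
      rw [Finset.sum_congr rfl h0, Finset.sum_const_zero, mul_zero]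
  rw [tsum_congr hterm, tsum_mul_left]
  congr 1
  -- the majorant `H(l) = 𝟙_{(l,N)=1} ‖κ_l Δ_l‖`
  set H : ℕ → ℝ := fun l => if Nat.Coprime l N then ‖κ l * Δ l‖ else 0 with hH
  have hnorm : ∀ θ : DirichletCharacter ℂ N, ∀ l, ‖κ l * θ (-(l : ZMod N)) * Δ l‖ = H l := by
    intro θ l
    rw [norm_mul, norm_mul, norm_char_neg_natCast' θ l, hH]
    by_cases hl : Nat.Coprime l N
    · simp only [if_pos hl, norm_mul]; ring
    · simp only [if_neg hl]; ring
  by_cases hsum : Summable H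
  · -- absolutely convergent: interchange the sums
    have hθ : ∀ θ ∈ S, Summable (fun l => c θ * (κ l * θ (-(l : ZMod N)) * Δ l)) := by
      intro θ _
      refine Summable.of_norm_bounded (hsum.mul_left ‖c θ‖) fun l => ?_
      rw [norm_mul, hnorm θ l]
    rw [Summable.tsum_finsetSum hθ]
    refine Finset.sum_congr rfl fun θ _ => ?_
    rw [tsum_mul_left]
  · -- not absolutely convergent: every series involved is `0`
    have hθ : ∀ θ : DirichletCharacter ℂ N, ¬ Summable (fun l => κ l * θ (-(l : ZMod N)) * Δ l) := by
      intro θ hθ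
      apply hsum
      have := summable_norm_iff.mpr hθ
      exact this.congr (hnorm θ)
    have hL : ¬ Summable (fun l => ∑ θ ∈ S, c θ * (κ l * θ (-(l : ZMod N)) * Δ l)) := by
      intro hsumL
      have h1 : Summable (fun l => (Nat.totient N : ℂ)⁻¹ *
          ∑ θ ∈ S, c θ * (κ l * θ (-(l : ZMod N)) * Δ l)) := hsumL.mul_left _
      have h2 : Summable (fun l : ℕ => if Nat.Coprime l N then
          κ l * Δ l * eAdd (-((l : ℝ) * nInv N p / (M * k))) else 0) := h1.congr fun l => (hterm l).symm
      apply hsum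
      have h3 := summable_norm_iff.mpr h2
      refine h3.congr fun l => ?_
      by_cases hl : Nat.Coprime l N
      · simp only [if_pos hl, hH, norm_mul, norm_eAdd_eq_one', mul_one]
      · simp only [if_neg hl, hH, norm_zero]
    rw [tsum_eq_zero_of_not_summable hL, eq_comm]
    refine Finset.sum_eq_zero fun θ _ => ?_
    rw [tsum_eq_zero_of_not_summable (hθ θ), mul_zero]

/-! ## (14.7)′: the character expansion of `𝒮(D₁,D₂;p)` -/

/-- For `D` large, `p ∼ P`, `1 ≤ k ≤ 2P₄` and `D₂ ∣ D`: `(p, D₂k) = 1` (indeed `(p, Dk) = 1`: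
`k ≤ 2P₄ ≤ P < p`, `D < P < p`). [cite: Zhang2022LandauSiegel, §14 u012 p.78] -/
theorem coprime_p_mul_of_dvd {Dl D p k D₂ : ℕ} (hDl : ∀ D : ℕ, Dl ≤ D → 2 * P4 D ≤ bigP D)
    (hD : Dl ≤ D) (hD3 : 3 ≤ D) (hp : p ∈ primeWindow D) (hk : k ∈ Finset.Icc 1 ⌊2 * P4 D⌋₊)
    (hD₂ : D₂ ∣ D) : Nat.Coprime p (D₂ * k) :=
  Nat.Coprime.coprime_dvd_right (Nat.mul_dvd_mul_right hD₂ k)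
    (coprime_of_mem_primeWindow_of_le hDl hD hD3 hp hk)

/-- **(14.7)′ — the character expansion of `𝒮(D₁,D₂;p)` at the modulus `D₂k`** (the twin of (14.7),
which is the case `(D₁,D₂) = (1,D)`): there is `D₀` such that for all `D ≥ D₀`, every `p ∼ P`, every
factorisation `D = D₁D₂` and all sequences `κ*, a*`,
`𝒮(D₁,D₂;p) = Σ_d d⁻¹ Σ_{(k,D₁)=1} a*(dk)/(kφ(D₂k)) Σ_{θ (mod D₂k)} τ(θ̄)θ̄(p) Σ_l κ*(D₁dl)θ(−l)Δ(l/(D₂pk))`,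
termwise by u012 at the modulus `D₂k` (`(p, D₂k) = 1` since `k ≤ 2P₄ ≤ P < p` and `D < p`), "the
constraint `(l,D₂k) = 1` removed as superfluous" (`θ(−l) = 0` otherwise), the order of `Σ_l`, `Σ_θ`
being immaterial (absolutely convergent, or every series `0`).
[cite: Zhang2022LandauSiegel, §14 (14.7) p.78 and (14.6) proof p.79, tex L3924, L3966–L3969] -/
theorem calS_charExpansion : ∃ D₀ : ℕ, ∀ D : ℕ, D₀ ≤ D → ∀ p ∈ primeWindow D,
    ∀ D₁ D₂ : ℕ, D₁ * D₂ = D → ∀ κs as : ℕ → ℂ,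
      calS D D₁ D₂ p κs as =
        ∑ d ∈ Finset.Icc 1 ⌊2 * P4 D⌋₊, (d : ℂ)⁻¹ *
          ∑ k ∈ (Finset.Icc 1 ⌊2 * P4 D⌋₊).filter (fun k => Nat.Coprime k D₁),
            as (d * k) / ((k : ℂ) * Nat.totient (D₂ * k)) *
              ∑ θ ∈ finsetOf (Set.univ : Set (DirichletCharacter ℂ (D₂ * k))),
                tauSum (D₂ * k) θ⁻¹ * θ⁻¹ (p : ZMod (D₂ * k)) *
                  ∑' l : ℕ, κs (D₁ * d * l) * θ (-(l : ZMod (D₂ * k))) *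
                    DeltaW D ((l : ℝ) / ((D₂ : ℝ) * p * k)) := by
  obtain ⟨Dl, hDl⟩ := exists_two_mul_P4_le_bigP
  refine ⟨max Dl 3, fun D hD p hp D₁ D₂ hD₁₂ κs as => ?_⟩
  have hDl' : Dl ≤ D := le_trans (le_max_left _ _) hD
  have hD3 : 3 ≤ D := le_trans (le_max_right _ _) hD
  have hD₂dvd : D₂ ∣ D := ⟨D₁, by rw [← hD₁₂, mul_comm]⟩
  have hD₂0 : 0 < D₂ := Nat.pos_of_ne_zero fun h => by subst h; omega
  unfold calS
  refine Finset.sum_congr rfl fun d _ => ?_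
  congr 1
  refine Finset.sum_congr rfl fun k hk => ?_
  have hk' : k ∈ Finset.Icc 1 ⌊2 * P4 D⌋₊ := (Finset.mem_filter.mp hk).1
  have hk0 : 0 < k := (Finset.mem_Icc.mp hk').1
  have hcop : Nat.Coprime p (D₂ * k) := coprime_p_mul_of_dvd hDl hDl' hD3 hp hk' hD₂dvd
  have key := tsum_coprime_twist_eq_sum_characters hD₂0 hk0 hcop (fun l => κs (D₁ * d * l))
    (fun l => DeltaW D ((l : ℝ) / ((D₂ : ℝ) * p * k)))
  beta_reduce at key
  rw [key]
  ring

/-! ## Exchanging `Σ_{p∼P}` with the `l`-series at the modulus `D₂k` -/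

section Window

variable {D : ℕ} (χ : DirichletCharacter ℂ D)

/-- **Exchanging `Σ_{p∼P}` with the `l`-series** at the modulus `D₂k` (absolutely convergent under
(14.1) by `summable_kappa_mul_DeltaW`), and `θ(−l) = θ(−1)θ(l)` — the twin of
`sum_window_tsum_exchange` (modulus `Dk`). [cite: Zhang2022LandauSiegel, §14 (14.8) p.79] -/
theorem sum_window_tsum_exchange₂ (hD : 3 ≤ D) {B : ℝ} {κs : ℕ → ℂ} (hκ : Eq141 B κs)
    (D₁ D₂ d k : ℕ) (hD₂ : 1 ≤ D₂) (hk : 1 ≤ k) (θ : DirichletCharacter ℂ (D₂ * k)) :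
    ∑ p ∈ primeWindow D, χ (p : ZMod D) * θ⁻¹ (p : ZMod (D₂ * k)) *
        ∑' l : ℕ, κs (D₁ * d * l) * θ (-(l : ZMod (D₂ * k))) *
          DeltaW D ((l : ℝ) / ((D₂ : ℝ) * p * k)) =
      θ (-1) * ∑' l : ℕ, κs (D₁ * d * l) * θ (l : ZMod (D₂ * k)) *
        ∑ p ∈ primeWindow D, χ (p : ZMod D) * θ⁻¹ (p : ZMod (D₂ * k)) *
          DeltaW D ((l : ℝ) / ((D₂ : ℝ) * p * k)) := by
  have hsum : ∀ p ∈ primeWindow D, Summable fun l : ℕ =>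
      χ (p : ZMod D) * θ⁻¹ (p : ZMod (D₂ * k)) *
        (κs (D₁ * d * l) * θ (-(l : ZMod (D₂ * k))) * DeltaW D ((l : ℝ) / ((D₂ : ℝ) * p * k))) := by
    intro p hp
    have hp0 : (0 : ℝ) < p := by exact_mod_cast (Finset.mem_filter.mp hp).2.pos
    have hD0 : (0 : ℝ) < D₂ := by exact_mod_cast hD₂
    have hk0 : (0 : ℝ) < k := by exact_mod_cast hk
    have hQ : (0 : ℝ) < (D₂ : ℝ) * p * k := by positivity
    exact (summable_kappa_mul_DeltaW hD hκ (D₁ * d) hQ (g := fun l => θ (-(l : ZMod (D₂ * k))))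
      (G := 1) (fun l => DirichletCharacter.norm_le_one θ _)).mul_left _
  calc ∑ p ∈ primeWindow D, χ (p : ZMod D) * θ⁻¹ (p : ZMod (D₂ * k)) *
        ∑' l : ℕ, κs (D₁ * d * l) * θ (-(l : ZMod (D₂ * k))) *
          DeltaW D ((l : ℝ) / ((D₂ : ℝ) * p * k))
      = ∑ p ∈ primeWindow D, ∑' l : ℕ, χ (p : ZMod D) * θ⁻¹ (p : ZMod (D₂ * k)) *
          (κs (D₁ * d * l) * θ (-(l : ZMod (D₂ * k))) *
            DeltaW D ((l : ℝ) / ((D₂ : ℝ) * p * k))) := by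
        refine Finset.sum_congr rfl fun p _ => ?_
        rw [tsum_mul_left]
    _ = ∑' l : ℕ, ∑ p ∈ primeWindow D, χ (p : ZMod D) * θ⁻¹ (p : ZMod (D₂ * k)) *
          (κs (D₁ * d * l) * θ (-(l : ZMod (D₂ * k))) *
            DeltaW D ((l : ℝ) / ((D₂ : ℝ) * p * k))) :=
        (Summable.tsum_finsetSum hsum).symm
    _ = ∑' l : ℕ, θ (-1) * (κs (D₁ * d * l) * θ (l : ZMod (D₂ * k)) *
          ∑ p ∈ primeWindow D, χ (p : ZMod D) * θ⁻¹ (p : ZMod (D₂ * k)) *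
            DeltaW D ((l : ℝ) / ((D₂ : ℝ) * p * k))) := by
        refine tsum_congr fun l => ?_
        have hneg : θ (-(l : ZMod (D₂ * k))) = θ (-1) * θ (l : ZMod (D₂ * k)) := by
          rw [← map_mul, neg_one_mul]
        rw [Finset.mul_sum, Finset.mul_sum]
        refine Finset.sum_congr rfl fun p _ => ?_
        rw [hneg]; ring
    _ = _ := tsum_mul_left

/-- **The non-principal characters' contribution, summed over the window, is bounded by the
(14.8)-shaped majorant at the modulus `D₂k`**: for `D ≥ 3`, under (14.1), any `D₁, D₂ ≥ 1`, any finite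
set `K` of `k ≥ 1` and any `a*`,
`‖Σ_{p∼P} χ(p) Σ_d d⁻¹ Σ_{k∈K} a*(dk)/(kφ(D₂k)) Σ_{θ≠ψ⁰} τ(θ̄)θ̄(p) Σ_l κ*(D₁dl)θ(−l)Δ(l/(D₂pk))‖
≤ Σ_d d⁻¹ Σ_{k∈K} |a*(dk)|/(φ(D₂k)k) Σ_{θ≠ψ⁰} |τ(θ̄)|·|Σ_l κ*(D₁dl)θ(l) Σ_{p∼P} χθ̄(p)Δ(l/(D₂pk))|`
(exchange of `Σ_{p∼P}` with the `l`-series, `|θ(−1)| ≤ 1`) — the twin of `norm_sum_window_rest_le`.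
[cite: Zhang2022LandauSiegel, §14 (14.8) p.79 and (14.6) proof p.79, tex L3945, L3966–L3969] -/
theorem norm_sum_window_nonprincipal_le₂ (hD : 3 ≤ D) {B : ℝ} {κs : ℕ → ℂ} (hκ : Eq141 B κs)
    (as : ℕ → ℂ) (D₁ D₂ : ℕ) (hD₂ : 1 ≤ D₂) (K : Finset ℕ) (hK : ∀ k ∈ K, 1 ≤ k) :
    ‖∑ p ∈ primeWindow D, χ (p : ZMod D) *
        ∑ d ∈ Finset.Icc 1 ⌊2 * P4 D⌋₊, (d : ℂ)⁻¹ * ∑ k ∈ K,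
          as (d * k) / ((k : ℂ) * Nat.totient (D₂ * k)) *
            ∑ θ ∈ finsetOf {θ : DirichletCharacter ℂ (D₂ * k) | θ ≠ 1},
              tauSum (D₂ * k) θ⁻¹ * θ⁻¹ (p : ZMod (D₂ * k)) *
                ∑' l : ℕ, κs (D₁ * d * l) * θ (-(l : ZMod (D₂ * k))) *
                  DeltaW D ((l : ℝ) / ((D₂ : ℝ) * p * k))‖ ≤
      ∑ d ∈ Finset.Icc 1 ⌊2 * P4 D⌋₊, (d : ℝ)⁻¹ * ∑ k ∈ K,
        ‖as (d * k)‖ / ((Nat.totient (D₂ * k) : ℝ) * k) *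
          ∑ θ ∈ finsetOf {θ : DirichletCharacter ℂ (D₂ * k) | θ ≠ 1},
            ‖tauSum (D₂ * k) θ⁻¹‖ *
              ‖∑' l : ℕ, κs (D₁ * d * l) * θ (l : ZMod (D₂ * k)) *
                  ∑ p ∈ primeWindow D, χ (p : ZMod D) * θ⁻¹ (p : ZMod (D₂ * k)) *
                    DeltaW D ((l : ℝ) / ((D₂ : ℝ) * p * k))‖ := by
  -- move the `p`-sum inside
  have hre : ∑ p ∈ primeWindow D, χ (p : ZMod D) *
        ∑ d ∈ Finset.Icc 1 ⌊2 * P4 D⌋₊, (d : ℂ)⁻¹ * ∑ k ∈ K,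
          as (d * k) / ((k : ℂ) * Nat.totient (D₂ * k)) *
            ∑ θ ∈ finsetOf {θ : DirichletCharacter ℂ (D₂ * k) | θ ≠ 1},
              tauSum (D₂ * k) θ⁻¹ * θ⁻¹ (p : ZMod (D₂ * k)) *
                ∑' l : ℕ, κs (D₁ * d * l) * θ (-(l : ZMod (D₂ * k))) *
                  DeltaW D ((l : ℝ) / ((D₂ : ℝ) * p * k)) =
      ∑ d ∈ Finset.Icc 1 ⌊2 * P4 D⌋₊, (d : ℂ)⁻¹ * ∑ k ∈ K,
          as (d * k) / ((k : ℂ) * Nat.totient (D₂ * k)) *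
            ∑ θ ∈ finsetOf {θ : DirichletCharacter ℂ (D₂ * k) | θ ≠ 1},
              tauSum (D₂ * k) θ⁻¹ * (θ (-1) * ∑' l : ℕ, κs (D₁ * d * l) * θ (l : ZMod (D₂ * k)) *
                ∑ p ∈ primeWindow D, χ (p : ZMod D) * θ⁻¹ (p : ZMod (D₂ * k)) *
                  DeltaW D ((l : ℝ) / ((D₂ : ℝ) * p * k))) := by
    -- both sides equal the quadruple sum with `p` innermost
    have lhs : ∑ p ∈ primeWindow D, χ (p : ZMod D) *
        ∑ d ∈ Finset.Icc 1 ⌊2 * P4 D⌋₊, (d : ℂ)⁻¹ * ∑ k ∈ K,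
          as (d * k) / ((k : ℂ) * Nat.totient (D₂ * k)) *
            ∑ θ ∈ finsetOf {θ : DirichletCharacter ℂ (D₂ * k) | θ ≠ 1},
              tauSum (D₂ * k) θ⁻¹ * θ⁻¹ (p : ZMod (D₂ * k)) *
                ∑' l : ℕ, κs (D₁ * d * l) * θ (-(l : ZMod (D₂ * k))) *
                  DeltaW D ((l : ℝ) / ((D₂ : ℝ) * p * k)) =
        ∑ d ∈ Finset.Icc 1 ⌊2 * P4 D⌋₊, ∑ k ∈ K,
          ∑ θ ∈ finsetOf {θ : DirichletCharacter ℂ (D₂ * k) | θ ≠ 1},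
            (d : ℂ)⁻¹ * (as (d * k) / ((k : ℂ) * Nat.totient (D₂ * k))) * tauSum (D₂ * k) θ⁻¹ *
              ∑ p ∈ primeWindow D, χ (p : ZMod D) * θ⁻¹ (p : ZMod (D₂ * k)) *
                ∑' l : ℕ, κs (D₁ * d * l) * θ (-(l : ZMod (D₂ * k))) *
                  DeltaW D ((l : ℝ) / ((D₂ : ℝ) * p * k)) := by
      simp only [Finset.mul_sum]
      rw [Finset.sum_comm]
      refine Finset.sum_congr rfl fun d _ => ?_
      rw [Finset.sum_comm]
      refine Finset.sum_congr rfl fun k _ => ?_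
      rw [Finset.sum_comm]
      refine Finset.sum_congr rfl fun θ _ => Finset.sum_congr rfl fun p _ => ?_
      ring
    rw [lhs]
    have step : ∀ d ∈ Finset.Icc 1 ⌊2 * P4 D⌋₊, ∀ k ∈ K,
        ∀ θ ∈ finsetOf {θ : DirichletCharacter ℂ (D₂ * k) | θ ≠ 1},
        (d : ℂ)⁻¹ * (as (d * k) / ((k : ℂ) * Nat.totient (D₂ * k))) * tauSum (D₂ * k) θ⁻¹ *
            ∑ p ∈ primeWindow D, χ (p : ZMod D) * θ⁻¹ (p : ZMod (D₂ * k)) *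
              ∑' l : ℕ, κs (D₁ * d * l) * θ (-(l : ZMod (D₂ * k))) *
                DeltaW D ((l : ℝ) / ((D₂ : ℝ) * p * k)) =
          (d : ℂ)⁻¹ * (as (d * k) / ((k : ℂ) * Nat.totient (D₂ * k)) *
            (tauSum (D₂ * k) θ⁻¹ * (θ (-1) * ∑' l : ℕ, κs (D₁ * d * l) * θ (l : ZMod (D₂ * k)) *
              ∑ p ∈ primeWindow D, χ (p : ZMod D) * θ⁻¹ (p : ZMod (D₂ * k)) *
                DeltaW D ((l : ℝ) / ((D₂ : ℝ) * p * k))))) := by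
      intro d _ k hk θ _
      rw [sum_window_tsum_exchange₂ χ hD hκ D₁ D₂ d k hD₂ (hK k hk) θ]
      ring
    rw [Finset.sum_congr rfl fun d hd => Finset.sum_congr rfl fun k hk =>
      Finset.sum_congr rfl fun θ hθ => step d hd k hk θ hθ]
    simp only [← Finset.mul_sum]
  rw [hre]
  -- termwise norm bounds through the three finite sums
  refine (norm_sum_le _ _).trans (Finset.sum_le_sum fun d _ => ?_)
  rw [norm_mul, norm_inv, Complex.norm_natCast]
  refine mul_le_mul_of_nonneg_left ?_ (by positivity)
  refine (norm_sum_le _ _).trans (Finset.sum_le_sum fun k _ => ?_)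
  rw [norm_mul, norm_div, norm_mul, Complex.norm_natCast, Complex.norm_natCast, mul_comm (k : ℝ)]
  refine mul_le_mul_of_nonneg_left ?_ (by positivity)
  refine (norm_sum_le _ _).trans (Finset.sum_le_sum fun θ _ => ?_)
  rw [norm_mul, norm_mul]
  refine mul_le_mul_of_nonneg_left ?_ (norm_nonneg _)
  calc ‖θ (-1)‖ * ‖∑' l : ℕ, κs (D₁ * d * l) * θ (l : ZMod (D₂ * k)) *
          ∑ p ∈ primeWindow D, χ (p : ZMod D) * θ⁻¹ (p : ZMod (D₂ * k)) *
            DeltaW D ((l : ℝ) / ((D₂ : ℝ) * p * k))‖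
      ≤ 1 * ‖∑' l : ℕ, κs (D₁ * d * l) * θ (l : ZMod (D₂ * k)) *
          ∑ p ∈ primeWindow D, χ (p : ZMod D) * θ⁻¹ (p : ZMod (D₂ * k)) *
            DeltaW D ((l : ℝ) / ((D₂ : ℝ) * p * k))‖ := by
        gcongr; exact DirichletCharacter.norm_le_one θ _
    _ = _ := one_mul _

end Window

/-! ## Splitting off the principal character -/

/-- Splitting a sum over all characters `θ (mod N)` into `θ = ψ⁰` and the rest.
[cite: Zhang2022LandauSiegel, §14 u013 p.78] -/
theorem sum_characters_split_one {N : ℕ} [NeZero N] (f : DirichletCharacter ℂ N → ℂ) :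
    ∑ θ ∈ finsetOf (Set.univ : Set (DirichletCharacter ℂ N)), f θ =
      f 1 + ∑ θ ∈ finsetOf {θ : DirichletCharacter ℂ N | θ ≠ 1}, f θ := by
  classical
  have hU : finsetOf (Set.univ : Set (DirichletCharacter ℂ N)) =
      insert 1 (finsetOf {θ : DirichletCharacter ℂ N | θ ≠ 1}) := by
    ext θ
    simp only [mem_finsetOf_iff' (Set.toFinite _), Set.mem_univ, Finset.mem_insert, Set.mem_setOf_eq,
      true_iff]
    tauto
  rw [hU, Finset.sum_insert]
  simp only [mem_finsetOf_iff' (Set.toFinite _), Set.mem_setOf_eq, ne_eq, not_true_eq_false,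
    not_false_eq_true]

/-- **The per-`p` decomposition of `𝒮(D₁,D₂;p)`** along `θ = ψ⁰_{D₂k}` and `θ ≠ ψ⁰_{D₂k}`, from the
(14.7)′-identity at `p` ("If `θ` is the principal character … then `τ(θ̄) = μ(D₂k)`"; for `D₁ > 1` no
non-principal `θ (mod D₂k)` with `(k,D₁) = 1` is induced by `χ`, so no further term is split off).
[cite: Zhang2022LandauSiegel, §14 u013 p.78 and (14.6) proof p.79, tex L3928, L3966–L3969] -/
theorem calS_split₂ {D : ℕ} (D₁ D₂ p : ℕ) (hD₂ : 0 < D₂) (κs as : ℕ → ℂ)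
    (h147 : calS D D₁ D₂ p κs as =
      ∑ d ∈ Finset.Icc 1 ⌊2 * P4 D⌋₊, (d : ℂ)⁻¹ *
        ∑ k ∈ (Finset.Icc 1 ⌊2 * P4 D⌋₊).filter (fun k => Nat.Coprime k D₁),
          as (d * k) / ((k : ℂ) * Nat.totient (D₂ * k)) *
            ∑ θ ∈ finsetOf (Set.univ : Set (DirichletCharacter ℂ (D₂ * k))),
              tauSum (D₂ * k) θ⁻¹ * θ⁻¹ (p : ZMod (D₂ * k)) *
                ∑' l : ℕ, κs (D₁ * d * l) * θ (-(l : ZMod (D₂ * k))) *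
                  DeltaW D ((l : ℝ) / ((D₂ : ℝ) * p * k))) :
    calS D D₁ D₂ p κs as =
      (∑ d ∈ Finset.Icc 1 ⌊2 * P4 D⌋₊, (d : ℂ)⁻¹ *
        ∑ k ∈ (Finset.Icc 1 ⌊2 * P4 D⌋₊).filter (fun k => Nat.Coprime k D₁),
          as (d * k) / ((k : ℂ) * Nat.totient (D₂ * k)) *
            (tauSum (D₂ * k) (1 : DirichletCharacter ℂ (D₂ * k))⁻¹ *
                (1 : DirichletCharacter ℂ (D₂ * k))⁻¹ (p : ZMod (D₂ * k)) *
              ∑' l : ℕ, κs (D₁ * d * l) * (1 : DirichletCharacter ℂ (D₂ * k)) (-(l : ZMod (D₂ * k))) *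
                DeltaW D ((l : ℝ) / ((D₂ : ℝ) * p * k)))) +
      ∑ d ∈ Finset.Icc 1 ⌊2 * P4 D⌋₊, (d : ℂ)⁻¹ *
        ∑ k ∈ (Finset.Icc 1 ⌊2 * P4 D⌋₊).filter (fun k => Nat.Coprime k D₁),
          as (d * k) / ((k : ℂ) * Nat.totient (D₂ * k)) *
            ∑ θ ∈ finsetOf {θ : DirichletCharacter ℂ (D₂ * k) | θ ≠ 1},
              tauSum (D₂ * k) θ⁻¹ * θ⁻¹ (p : ZMod (D₂ * k)) *
                ∑' l : ℕ, κs (D₁ * d * l) * θ (-(l : ZMod (D₂ * k))) *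
                  DeltaW D ((l : ℝ) / ((D₂ : ℝ) * p * k)) := by
  rw [h147, ← Finset.sum_add_distrib]
  refine Finset.sum_congr rfl fun d _ => ?_
  rw [← mul_add, ← Finset.sum_add_distrib]
  congr 1
  refine Finset.sum_congr rfl fun k hk => ?_
  have hk0 : k ≠ 0 := by have := (Finset.mem_Icc.mp (Finset.mem_filter.mp hk).1).1; omega
  haveI : NeZero (D₂ * k) := ⟨mul_ne_zero hD₂.ne' hk0⟩
  rw [sum_characters_split_one, mul_add]

end Literature.NumberTheory.LFunctions.Zhang2022.Typed.Sec14
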